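import Literature.Computation.Certificates.GramSOSRows
import Literature.Computation.Certificates.Data

/-!
# Gram-form SOS certificates on LIST carriers, with a ROW-RANGE-SEPARABLE residual (`decide +kernel`)

Compute-infrastructure file, a companion of `GramSOS.lean` / `GramSOSRows.lean` / `Data.lean`
(ladder GRIDFUSION, director RULING 19: the list-refined PSD lane `PosSemidefIntList.lean` is
row-separable across proof files, the residual zero-test of `GramSOSRows` is not — it is ONE
`decide` per identity, «no block-splitting of the row fold itself»). This file performs, for the
RESIDUAL side of a Gram-form Positivstellensatz certificate
`p = σ₀ + Σᵢ gᵢ σᵢ + Σⱼ hⱼ tⱼ` (`σ` Gram-form SOS, [cite: BlekhermanParriloThomas2012, Thm 3.127]),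
the same DATA REFINEMENT step that `PosSemidefIntList.lean` performs for the PSD side
(«specialize the algorithms with effective datatypes and prove them correct with respect to the
proof-oriented datatypes», [cite: MartinDorelRoux2017, §3]), and adds an additive split of the
big free block into row ranges whose exact partial sums are shipped as data:

* `SOS.GramL` — a Gram block on plain `List` carriers (`basis : List Monomial`,
  `Q : List (List ℚ)` by rows, optional rounded factor `d`, `B` by rows); `GramL.toGramSOS` is its
  `Fin`-indexed view (`funOfList` / `matrixOfRows` / `vecOfList`), so EVERY PSD fact of the
  directory feeds it unchanged: `GramSOS.quadNonneg_of_valid` (ℚ rounded certificate),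
  `GramSOS.quadNonneg_of_gramCertZ` (+ `PSD.IsGramCertZ.of_listCheck'`, the L3 lane),
  `SOS.GramSOS.quadNonneg_of_packed` (packed lane); `GramL.quadNonneg_of_gramCertZ` packages the
  integer lane with a list-computed scaling test `scaleOK` (`A = c • Q` entrywise).
* `GramL.gramRows srt basis heads rows` — the Gram polynomial `Σ_a m_a · (Σ_b Q_ab m_b)` computed
  by ONE zip pass per row over the row list and the basis list (sequential access — no `Fin`,
  `Fin.cases`/`vecCons` or `List.getD` indexing inside the reduction, no per-row insertion
  `Poly.norm`; rows merge-sorted only if the basis is not `blt`-ascending, `GramL.ascending`),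
  rows folded with the sorted merge `Poly.add`; `GramL.poly`, and `GramL.polyRange g lo n` = rows
  `lo ≤ a < lo + n` only. Semantics `GramL.eval_poly` (= the quadratic form of `matrixOfRows … Q`
  at the basis values, i.e. `GramSOS.eval_poly` of the view) and ADDITIVITY over row ranges
  (`GramL.eval_chunks_sum`, `GramL.eval_chunks_cover`).
* ROW-RANGE SPLIT: the producer ships exact partial sums `P_t` (rows `[a_t, a_t + n_t)` of the
  free block) as `Poly` literals; proof file `t` decides ONLY `isZero (P_t − polyRange a_t n_t)`
  (cost ∝ its `n_t` rows), the main file decides the small identity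
  `p = Σ_t P_t + Σᵢ gᵢ σᵢ + Σⱼ hⱼ tⱼ` (`Poly.residualL`); `GramL.ChunkEqs` collects the per-range
  facts (a nested `∧`, assembled from the part files' theorems by `⟨h₀, h₁, …, trivial⟩`), and
  **`Poly.nonneg_of_chunksL`** is the soundness theorem — same conclusion as
  `Poly.nonneg_of_quadGR`: `0 ≤ p.eval x` wherever `g ≥ 0` for `g ∈ gs` and `h = 0` for `h ∈ hs`.
  **`Poly.nonneg_of_quadL`** is the unsplit one-`decide` form (`Poly.residualL1`).
* K-SUM2 (Appendix B, 2026-08-27): a SECOND summation level — every summand (row-range part,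
  shipped multiplier product `Poly.MultEqs`, shipped equality product `Poly.EqMultEqs`) and the
  target are shipped in SLICES (a row-major matrix, `Poly.col` / `Poly.rowsFit`); one `decide` per
  column (`Poly.SliceEqs`) replaces the single big `residualL` decide; soundness
  **`Poly.nonneg_of_slicesL`** concludes `0 ≤ (pS.flatten).eval x` (`Poly.eval_flatten`).
* Multiplier products `gᵢ · σᵢ` iterate over the SHORTER factor (`Poly.mulShort`): `Poly.mul p q`
  costs `|p|` merges, so a 250-term `g` against a 28-term `σ` is taken as `σ · g`.

Soundness never depends on term order; COMPLETENESS of the zero tests (full cancellation inside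
the sorted merge) wants the basis emitted in `Monomial.blt`-ascending order (then every row comes
out sorted, since `blt` on trimmed exponent vectors is a monomial order) and `p`, `P_t`, `gᵢ`,
`hⱼ`, `tⱼ` trimmed and `blt`-ascending; anything else only leaves like terms for `Poly.collect`
(quadratic) or makes a zero test fail — never a wrong `true`.

Cost per identity: `Σ_blocks s²` monomial products + `Σ_blocks s` merges of `≤ T` terms (`T` =
number of monomials of the identity) + the multiplier products; every intermediate list has at
most `T` terms; each row range is its own kernel reduction (memory as in `Blocks.lean`).
Measured (farm, `decide +kernel`, 2026-08-27, synthetic dense exact blocks `Q = BᵀDB`, no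
multipliers, kernel time = wall minus the file's own data elaboration): `s = 84`, 6 variables,
924-term target, 18-digit `ℚ` (the regime of `GramSOSRows`' budget of record): unsplit
`residualL1` ≈ 19 s vs `residualGR` ≈ 43 s on identical ascending data; with the SAME data in
descending order `residualL1` ≈ 45 s while `residualGR` does not finish inside one `decide`
(insertion `norm`, ≥ 170 s then failure); split into 3 ranges of 28 rows: ≈ 14 / 11 / 7 s + main
≈ 3 s. `s = 120`, 7 variables, 1716-term target, 57-digit `ℚ` (a deg-4 multimachine `V̇` block):
5 ranges of 24 rows ≈ 16–19 s kernel each (≈ 80 s in all), every file < 300 KB — a block the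
one-`decide` lanes cannot state in one file under the farm's byte cap.
Kernel-checked tests at the end (the `GramSOSRows.lean` examples through the list carriers, a
two-chunk split, and the integer PSD lane through `scaleOK`).

References: [cite: BlekhermanParriloThomas2012, Thm 3.39] (Gram form), [cite:
BlekhermanParriloThomas2012, Thm 3.127] (Positivstellensatz certificates),
[cite: MartinDorelRoux2017, §3] (data refinement of certified checkers, after CoqEAL);
row-range additivity is [folklore].
Not here: no change to `CertG` / `checkG` / `checkGR` (consumed as they are elsewhere); no PSD
check (supplied per block by the existing lanes); no `native_decide`.
-/

namespace Literature.Computation.Certificates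

namespace SOS

open Poly

/-! ### Merge-sort normalisation of term lists -/

namespace Poly

section NormM

variable {R : Type*} [Field R] [CharZero R]

/-- **Merge-sort normalisation** with fuel `f`: split the term list in halves, normalise both,
merge with `Poly.add` (like terms combined, created zeros dropped) — `O(T log T)` comparisons
WHATEVER the input order, where the insertion-based `Poly.norm` is `O(T²)` on descending input
(measured: a 924-term target in descending order does not pass the farm inside one `decide` at
`s = 84`, ascending passes in 43 s). Out of fuel it falls back to `Poly.norm`. An effective
(computation-oriented) twin of `Poly.norm` in the sense of data refinement. [cite: MartinDorelRoux2017, §3] -/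
def normM : ℕ → Poly → Poly
  | 0, p => norm p
  | _ + 1, [] => []
  | _ + 1, [(m, c)] => [(Monomial.trim m, c)]
  | f + 1, t₁ :: t₂ :: rest =>
    add (normM f ((t₁ :: t₂ :: rest).take ((rest.length + 2) / 2)))
      (normM f ((t₁ :: t₂ :: rest).drop ((rest.length + 2) / 2)))

/-- Merge-sort normalisation of a term list (fuel = its length, always enough). [folklore] -/
def normMS (p : Poly) : Poly := normM p.length p

/-- Correctness of the effective normalisation w.r.t. the semantics `eval` (any fuel): the
refinement lemma that lets it replace `Poly.norm`. [cite: MartinDorelRoux2017, §3] -/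
@[simp] theorem eval_normM (x : ℕ → R) : ∀ (f : ℕ) (p : Poly), eval x (normM f p) = eval x p
  | 0, p => by rw [normM, eval_norm]
  | _ + 1, [] => by rw [normM]
  | _ + 1, [(m, c)] => by
      rw [normM, eval_cons, eval_cons, eval_nil, Monomial.eval_eq, Monomial.eval_eq,
        Monomial.evalFrom_trim]
  | f + 1, t₁ :: t₂ :: rest => by
      rw [normM, eval_add, eval_normM x f, eval_normM x f, ← eval_append, List.take_append_drop]

/-- Correctness of `normMS` w.r.t. `eval`. [cite: MartinDorelRoux2017, §3] -/
@[simp] theorem eval_normMS (x : ℕ → R) (p : Poly) : eval x (normMS p) = eval x p :=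
  eval_normM x _ p

end NormM

end Poly

/-! ### Gram blocks on list carriers -/

/-- A **Gram-form SOS block on list carriers**: the monomial basis `m_0, …, m_{s-1}` as a list,
the Gram matrix `Q` by rows, and (optionally) the rounded factorisation data `d`, `B` (by rows)
for the `ℚ` diagonal-dominance lane; read through `List.getD` with default `0` / `[]` past the
ends exactly as in `Data.lean`. [cite: BlekhermanParriloThomas2012, Thm 3.39] -/
structure GramL where
  /-- The monomial basis, in order. -/
  basis : List Monomial
  /-- The rows of the Gram matrix `Q`. -/
  Q : List (List ℚ)
  /-- Weights of a rounded `LDLᵀ`-type factorisation of `Q` (may be empty if PSD is supplied by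
  another lane). -/
  d : List ℚ := []
  /-- Rows of the factor `B` of that factorisation. -/
  B : List (List ℚ) := []

namespace GramL

/-- Size of the basis. [folklore] -/
def s (g : GramL) : ℕ := g.basis.length

/-- Number of factor rows. [folklore] -/
def m (g : GramL) : ℕ := g.d.length

/-- The basis as a `Fin s`-indexed family (`funOfList`). [folklore] -/
def mb (g : GramL) : Fin g.s → Monomial := funOfList [] g.s g.basis

/-- The Gram matrix as a `Matrix (Fin s) (Fin s) ℚ` (`matrixOfRows`). [folklore] -/
def mat (g : GramL) : Matrix (Fin g.s) (Fin g.s) ℚ := matrixOfRows g.s g.s g.Q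

/-- The `Fin`-indexed view of a list block as a `GramSOS` record (basis `funOfList`, matrices
`matrixOfRows`, weights `vecOfList`): the object the PSD lanes of this directory speak about.
[cite: BlekhermanParriloThomas2012, Thm 3.39] -/
def toGramSOS (g : GramL) : GramSOS :=
  ⟨g.s, g.m, g.mb, g.mat, vecOfList g.m g.d, matrixOfRows g.m g.s g.B⟩

/-- The view has the block's size. [folklore] -/
@[simp] private theorem toGramSOS_s (g : GramL) : g.toGramSOS.s = g.s := rfl

/-- The view has the block's Gram matrix. [folklore] -/
@[simp] private theorem toGramSOS_Q (g : GramL) : g.toGramSOS.Q = g.mat := rfl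

/-- The view has the block's basis. [folklore] -/
@[simp] private theorem toGramSOS_mb (g : GramL) : g.toGramSOS.mb = g.mb := rfl

/-! ### Row polynomials by one zip pass -/

/-- One row of the Gram form on list carriers: the terms `(m_a · m_b, q_ab)` for `b = 0, 1, …`,
zipping the row `(q_ab)_b` of `Q` with the basis (stops at the shorter list; zero entries are
skipped). [cite: BlekhermanParriloThomas2012, Thm 3.39] -/
def rowTermsL (ma : Monomial) : List ℚ → List Monomial → Poly
  | q :: qs, mb :: mbs =>
    if q = 0 then rowTermsL ma qs mbs else (Monomial.mul ma mb, q) :: rowTermsL ma qs mbs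
  | _, _ => []

/-- The basis is STRICTLY ASCENDING for `Monomial.blt` (adjacent test, `O(s)`). When it is,
every row term list of `rowTermsL` is already sorted (`blt` on trimmed exponent vectors is a
monomial order), so rows can be merged as they are; otherwise each row is merge-sort normalised
first (`Poly.normMS`) — completeness of the zero tests in either case, at `O(s log s)` extra per
row only in the second. [folklore] -/
def ascending : List Monomial → Bool
  | m₁ :: m₂ :: rest => Monomial.blt m₁ m₂ && ascending (m₂ :: rest)
  | _ => true

/-- A row term list, merge-sort normalised unless the basis is known ascending (`srt = true`).
[folklore] -/
def rowPolyL (srt : Bool) (ma : Monomial) (row : List ℚ) (basis : List Monomial) : Poly :=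
  if srt then rowTermsL ma row basis else Poly.normMS (rowTermsL ma row basis)

/-- The Gram polynomial of the rows whose head monomials are `heads` (with their rows of `Q`),
against the full `basis`: `Σ_a m_a · (Σ_b Q_ab m_b)`, the row term lists folded with the sorted
merge `Poly.add`. [cite: BlekhermanParriloThomas2012, Thm 3.39] -/
def gramRows (srt : Bool) (basis : List Monomial) : List Monomial → List (List ℚ) → Poly
  | ma :: mas, row :: rows => Poly.add (rowPolyL srt ma row basis) (gramRows srt basis mas rows)
  | _, _ => []

/-- The Gram polynomial `m(x)ᵀ Q m(x)` of a list block (all rows). [cite: BlekhermanParriloThomas2012, Thm 3.39] -/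
def poly (g : GramL) : Poly := gramRows (ascending g.basis) g.basis g.basis g.Q

/-- The rows `lo ≤ a < lo + n` of the Gram polynomial of a list block (a row RANGE; ranges beyond
the data are empty). [folklore] -/
def polyRange (g : GramL) (lo n : ℕ) : Poly :=
  gramRows (ascending g.basis) g.basis ((g.basis.drop lo).take n) ((g.Q.drop lo).take n)

/-- The consecutive row ranges of lengths `ns = [n₀, n₁, …]` starting at row `lo`:
`[lo, lo+n₀), [lo+n₀, lo+n₀+n₁), …`. [folklore] -/
def chunks (g : GramL) : ℕ → List ℕ → List Poly
  | _, [] => []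
  | lo, n :: ns => g.polyRange lo n :: g.chunks (lo + n) ns

section Eval

variable {R : Type*} [Field R] [CharZero R]

omit [CharZero R] in
/-- Semantics of one row: `Σ_{b < |mbs|} q_b · (m_a(x) · m_b(x))` with `q_b = 0` past the end of
the row. [cite: BlekhermanParriloThomas2012, Thm 3.39] -/
theorem eval_rowTermsL (x : ℕ → R) (ma : Monomial) : ∀ (mbs : List Monomial) (qs : List ℚ),
    (rowTermsL ma qs mbs).eval x =
      ∑ b : Fin mbs.length, (qs.getD b.val 0 : R) * (ma.eval x * (mbs.getD b.val []).eval x)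
  | [], qs => by cases qs <;> simp [rowTermsL]
  | mb :: mbs, [] => by simp [rowTermsL]
  | mb :: mbs, q :: qs => by
      rw [rowTermsL]
      simp only [List.length_cons, Fin.sum_univ_succ, Fin.val_zero, Fin.val_succ,
        List.getD_cons_zero, List.getD_cons_succ]
      split_ifs with hq
      · rw [eval_rowTermsL x ma mbs qs, hq, Rat.cast_zero, zero_mul, zero_add]
      · rw [Poly.eval_cons, eval_rowTermsL x ma mbs qs, Monomial.eval_mul]

/-- The optional per-row normalisation does not change the value. [folklore] -/
private theorem eval_rowPolyL (x : ℕ → R) (srt : Bool) (ma : Monomial) (row : List ℚ)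
    (basis : List Monomial) : (rowPolyL srt ma row basis).eval x = (rowTermsL ma row basis).eval x := by
  unfold rowPolyL; split_ifs <;> simp

/-- Semantics of the row fold: the double sum `Σ_{a < |heads|} Σ_{b < |basis|} Q_ab · m_a(x) m_b(x)`
read through `List.getD`. [cite: BlekhermanParriloThomas2012, Thm 3.39] -/
theorem eval_gramRows (x : ℕ → R) (srt : Bool) (basis : List Monomial) :
    ∀ (heads : List Monomial) (rows : List (List ℚ)), (gramRows srt basis heads rows).eval x =
      ∑ a : Fin heads.length, ∑ b : Fin basis.length, ((rows.getD a.val []).getD b.val 0 : R) *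
        ((heads.getD a.val []).eval x * (basis.getD b.val []).eval x)
  | [], rows => by cases rows <;> simp [gramRows]
  | ma :: mas, [] => by simp [gramRows]
  | ma :: mas, row :: rows => by
      rw [gramRows, Poly.eval_add, eval_rowPolyL, eval_rowTermsL, eval_gramRows x srt basis mas rows]
      simp only [List.length_cons, Fin.sum_univ_succ, Fin.val_zero, Fin.val_succ,
        List.getD_cons_zero, List.getD_cons_succ]

/-- **Semantics of the list Gram polynomial**: the quadratic form of `matrixOfRows s s Q` at the
vector of basis values. [cite: BlekhermanParriloThomas2012, Thm 3.39] -/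
theorem eval_poly (g : GramL) (x : ℕ → R) :
    g.poly.eval x = ∑ a : Fin g.s, ∑ b : Fin g.s, (g.mat a b : R) * ((g.mb a).eval x * (g.mb b).eval x) :=
  eval_gramRows x _ g.basis g.basis g.Q

/-- The list Gram polynomial has the same values as `GramSOS.poly` of the view.
[cite: BlekhermanParriloThomas2012, Thm 3.39] -/
theorem eval_poly_toGramSOS (g : GramL) (x : ℕ → R) : g.poly.eval x = g.toGramSOS.poly.eval x := by
  rw [eval_poly, GramSOS.eval_poly]
  exact Finset.sum_congr rfl fun a _ => Finset.sum_congr rfl fun b _ => by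
    simp only [toGramSOS_mb, toGramSOS_Q]; ring

/-- Additivity of the row fold over concatenated, ALIGNED row ranges. [folklore] -/
private theorem eval_gramRows_append (x : ℕ → R) (srt : Bool) (basis : List Monomial) :
    ∀ (h₁ h₂ : List Monomial) (r₁ r₂ : List (List ℚ)), h₁.length = r₁.length →
      (gramRows srt basis (h₁ ++ h₂) (r₁ ++ r₂)).eval x =
        (gramRows srt basis h₁ r₁).eval x + (gramRows srt basis h₂ r₂).eval x
  | [], h₂, [], r₂, _ => by simp [gramRows]
  | [], _, _ :: _, _, h => by simp at h
  | _ :: _, _, [], _, h => by simp at h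
  | ma :: mas, h₂, row :: rows, r₂, h => by
      rw [List.cons_append, List.cons_append, gramRows, gramRows, Poly.eval_add, Poly.eval_add,
        eval_gramRows_append x srt basis mas h₂ rows r₂ (by simpa using h), add_assoc]

/-- **Additivity over consecutive row ranges** of the Gram form `Σ_a Σ_b Q_ab m_a m_b`: the chunk
values add up to the value of the range they tile (needs `Q` to have exactly `s` rows, so that
ranges of the basis and of `Q` stay aligned). [cite: BlekhermanParriloThomas2012, Thm 3.39] -/
theorem eval_chunks_sum (g : GramL) (x : ℕ → R) (hQ : g.Q.length = g.s) :
    ∀ (ns : List ℕ) (lo : ℕ),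
      ((g.chunks lo ns).map (Poly.eval x)).sum = (g.polyRange lo ns.sum).eval x
  | [], lo => by simp [chunks, polyRange, gramRows]
  | n :: ns, lo => by
      rw [chunks, List.map_cons, List.sum_cons, eval_chunks_sum g x hQ ns (lo + n), List.sum_cons,
        polyRange, polyRange, polyRange, List.take_add, List.take_add, List.drop_drop, List.drop_drop,
        eval_gramRows_append]
      simp [List.length_take, List.length_drop, hQ, s]

/-- Ranges that tile at least all `s` rows give the whole Gram polynomial `m(x)ᵀ Q m(x)`.
[cite: BlekhermanParriloThomas2012, Thm 3.39] -/
theorem eval_chunks_cover (g : GramL) (x : ℕ → R) (hQ : g.Q.length = g.s) {ns : List ℕ}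
    (hcov : g.s ≤ ns.sum) : ((g.chunks 0 ns).map (Poly.eval x)).sum = g.poly.eval x := by
  rw [eval_chunks_sum g x hQ ns 0, polyRange, poly, List.drop_zero, List.drop_zero,
    List.take_of_length_le hcov, List.take_of_length_le (hQ ▸ hcov)]

end Eval

section Ordered

variable {R : Type*} [Field R] [LinearOrder R] [IsStrictOrderedRing R]

/-- A list block whose Gram matrix has nonnegative quadratic form (`GramSOS.QuadNonneg` of the
view, from ANY lane) is a nonnegative polynomial. [cite: BlekhermanParriloThomas2012, Thm 3.39] -/
theorem eval_poly_nonneg_of_quadNonneg (g : GramL) (h : g.toGramSOS.QuadNonneg R) (x : ℕ → R) :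
    0 ≤ g.poly.eval x := by
  rw [eval_poly_toGramSOS]
  exact g.toGramSOS.eval_poly_nonneg_of_quadNonneg h x

/-- The EMPTY Gram block (an identity without free SOS part) has nonnegative quadratic form
trivially. [cite: BlekhermanParriloThomas2012, Thm 3.39] -/
theorem quadNonneg_of_nil (g : GramL) (h : g.basis = []) : g.toGramSOS.QuadNonneg R := by
  intro y
  have : IsEmpty (Fin g.toGramSOS.s) := by
    rw [toGramSOS_s, s, h, List.length_nil]; infer_instance
  exact (Finset.sum_eq_zero fun a _ => isEmptyElim a).symm.le

end Ordered

/-! ### The integer PSD lane: list-computed scaling test `A = c • Q` -/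

/-- Fuel-indexed entrywise test `a_j = c · q_j` along a row of `A` (integers) and a row of `Q`,
for the first `k` positions, missing entries read as `0`. [folklore] -/
def scaleRowOK (c : ℚ) : ℕ → List ℤ → List ℚ → Bool
  | 0, _, _ => true
  | k + 1, as, qs => decide (((as.headD 0 : ℤ) : ℚ) = c * qs.headD 0) && scaleRowOK c k as.tail qs.tail

/-- Fuel-indexed row-by-row test `A = c • Q` on the leading `k × n` entries. [folklore] -/
def scaleOK (c : ℚ) (n : ℕ) : ℕ → List (List ℤ) → List (List ℚ) → Bool
  | 0, _, _ => true
  | k + 1, Ar, Qr => scaleRowOK c n (Ar.headD []) (Qr.headD []) && scaleOK c n k Ar.tail Qr.tail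

/-- `l.getD 0 x` is the head with default. [folklore] -/
private theorem getD_zero_eq_headD' {α : Type*} (l : List α) (x : α) : l.getD 0 x = l.headD x := by
  cases l with
  | nil => simp
  | cons a as => exact List.getD_cons_zero

/-- `l.getD (k+1) x` is `getD k` of the tail. [folklore] -/
private theorem getD_succ_eq_getD_tail' {α : Type*} (l : List α) (k : ℕ) (x : α) :
    l.getD (k + 1) x = l.tail.getD k x := by
  cases l with
  | nil => simp
  | cons a as => exact List.getD_cons_succ

/-- Specification of the row test. [folklore] -/
private theorem scaleRowOK_spec (c : ℚ) : ∀ (k : ℕ) (as : List ℤ) (qs : List ℚ),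
    scaleRowOK c k as qs = true → ∀ j < k, ((as.getD j 0 : ℤ) : ℚ) = c * qs.getD j 0
  | 0, _, _, _, j, hj => absurd hj (Nat.not_lt_zero j)
  | k + 1, as, qs, h, j, hj => by
      simp only [scaleRowOK, Bool.and_eq_true, decide_eq_true_eq] at h
      rcases j with _ | j
      · rw [getD_zero_eq_headD', getD_zero_eq_headD']; exact h.1
      · rw [getD_succ_eq_getD_tail', getD_succ_eq_getD_tail']
        exact scaleRowOK_spec c k as.tail qs.tail h.2 j (by omega)

/-- Specification of the matrix test. [folklore] -/
private theorem scaleOK_spec' (c : ℚ) (n : ℕ) : ∀ (k : ℕ) (Ar : List (List ℤ)) (Qr : List (List ℚ)),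
    scaleOK c n k Ar Qr = true → ∀ i < k, ∀ j < n,
      (((Ar.getD i []).getD j 0 : ℤ) : ℚ) = c * (Qr.getD i []).getD j 0
  | 0, _, _, _, i, hi, _, _ => absurd hi (Nat.not_lt_zero i)
  | k + 1, Ar, Qr, h, i, hi, j, hj => by
      simp only [scaleOK, Bool.and_eq_true] at h
      rcases i with _ | i
      · rw [getD_zero_eq_headD', getD_zero_eq_headD']; exact scaleRowOK_spec c n _ _ h.1 j hj
      · rw [getD_succ_eq_getD_tail', getD_succ_eq_getD_tail']
        exact scaleOK_spec' c n k Ar.tail Qr.tail h.2 i (by omega) j hj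

/-- **A passing `scaleOK` is the `Fin`-statement `A = c • Q`** for the `matrixOfRows` carriers
(correctness of the effective test w.r.t. the proof-oriented matrices). [cite: MartinDorelRoux2017, §3] -/
theorem scaleOK_spec {c : ℚ} {n : ℕ} {Ar : List (List ℤ)} {Qr : List (List ℚ)}
    (h : scaleOK c n n Ar Qr = true) (i j : Fin n) :
    ((matrixOfRows n n Ar i j : ℤ) : ℚ) = c * matrixOfRows n n Qr i j := by
  simp only [matrixOfRows_apply]
  exact scaleOK_spec' c n n Ar Qr h i.val i.isLt j.val j.isLt

section OrderedZ

variable {R : Type*} [Field R] [LinearOrder R] [IsStrictOrderedRing R]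

/-- **Integer PSD lane for a list block**: an integer rounded Gram certificate
`PSD.IsGramCertZ (matrixOfRows s s Arows) d B` (from `PosSemidefInt.lean`, or its list-refined
form `PSD.IsGramCertZ.of_listCheck'`, or the packed checker) of a positive multiple `A = c • Q`
(tested by `scaleOK`, `0 < c`) gives `QuadNonneg` of the view.
[cite: BlekhermanParriloThomas2012, App. A.1.2] -/
theorem quadNonneg_of_gramCertZ (g : GramL) {m : ℕ} {Arows : List (List ℤ)} {d : Fin m → ℕ}
    {B : Matrix (Fin m) (Fin g.s) ℤ} (h : PSD.IsGramCertZ (matrixOfRows g.s g.s Arows) d B)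
    {c : ℚ} (hc : 0 < c) (hA : scaleOK c g.s g.s Arows g.Q = true) : g.toGramSOS.QuadNonneg R :=
  g.toGramSOS.quadNonneg_of_gramCertZ h hc fun i j => scaleOK_spec hA i j

end OrderedZ

/-! ### Row-range facts shipped as data -/

/-- **Chunk equalities**: `parts = [P₀, P₁, …]` are, range by range, the Gram polynomials of the
consecutive row ranges of lengths `ns = [n₀, n₁, …]` from row `lo` on — each conjunct
`isZero (P_t − polyRange a_t n_t) = true` is ONE `decide +kernel`, typically in its own file; the
conjunction is assembled by `⟨h₀, h₁, …, trivial⟩`. Length mismatch is `False`. [folklore] -/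
def ChunkEqs (g : GramL) : ℕ → List ℕ → List Poly → Prop
  | lo, n :: ns, P :: Ps =>
    isZero (Poly.add (Poly.normMS P) (Poly.neg (g.polyRange lo n))) = true ∧ g.ChunkEqs (lo + n) ns Ps
  | _, [], [] => True
  | _, [], _ :: _ => False
  | _, _ :: _, [] => False

section EvalChunks

variable {R : Type*} [Field R] [CharZero R]

/-- The shipped parts evaluate like the row ranges of the Gram form they certify.
[cite: BlekhermanParriloThomas2012, Thm 3.39] -/
theorem ChunkEqs.sum_eq (g : GramL) (x : ℕ → R) : ∀ (lo : ℕ) (ns : List ℕ) (Ps : List Poly),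
    g.ChunkEqs lo ns Ps → (Ps.map (Poly.eval x)).sum = ((g.chunks lo ns).map (Poly.eval x)).sum
  | lo, [], [], _ => by simp [chunks]
  | lo, [], _ :: _, h => by simp [ChunkEqs] at h
  | lo, _ :: _, [], h => by simp [ChunkEqs] at h
  | lo, n :: ns, P :: Ps, h => by
      simp only [ChunkEqs] at h
      have e := Poly.eval_eq_zero_of_isZero x h.1
      rw [Poly.eval_add, Poly.eval_normMS, Poly.eval_neg] at e
      rw [List.map_cons, List.sum_cons, chunks, List.map_cons, List.sum_cons,
        ChunkEqs.sum_eq g x (lo + n) ns Ps h.2]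
      linear_combination e

/-- **Parts tiling all rows sum to the Gram polynomial `m(x)ᵀ Q m(x)`.**
[cite: BlekhermanParriloThomas2012, Thm 3.39] -/
theorem ChunkEqs.sum_eq_poly (g : GramL) (x : ℕ → R) (hQ : g.Q.length = g.s) {ns : List ℕ}
    {Ps : List Poly} (hcov : g.s ≤ ns.sum) (h : g.ChunkEqs 0 ns Ps) :
    (Ps.map (Poly.eval x)).sum = g.poly.eval x := by
  rw [ChunkEqs.sum_eq g x 0 ns Ps h, eval_chunks_cover g x hQ hcov]

end EvalChunks

end GramL

namespace Poly

section CharZero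

variable {R : Type*} [Field R] [CharZero R]

/-- Product taken with the SHORTER factor outside (`Poly.mul p q` performs `|p|` merges).
[folklore] -/
def mulShort (p q : Poly) : Poly :=
  if p.length ≤ q.length then mul p q else mul q p

/-- `mulShort` is multiplicative. [folklore] -/
@[simp] private theorem eval_mulShort (x : ℕ → R) (p q : Poly) : eval x (mulShort p q) = eval x p * eval x q := by
  unfold mulShort; split_ifs <;> simp [mul_comm]

/-- Sum of a list of polynomials (each merge-sort normalised, folded with the sorted merge).
[folklore] -/
def sumPolys : List Poly → Poly
  | [] => []
  | P :: Ps => add (normMS P) (sumPolys Ps)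

/-- `eval` of `sumPolys`. [folklore] -/
private theorem eval_sumPolys (x : ℕ → R) : ∀ Ps : List Poly, eval x (sumPolys Ps) = (Ps.map (eval x)).sum
  | [] => rfl
  | P :: Ps => by rw [sumPolys, eval_add, eval_normMS, eval_sumPolys x Ps, List.map_cons, List.sum_cons]

/-- The inequality part `Σᵢ gᵢ · σᵢ` with list Gram blocks (matched by position; `gᵢ` merge-sort
normalised; the product iterates over the shorter factor). [cite: BlekhermanParriloThomas2012, Thm 3.127] -/
def ineqPartL : List Poly → List GramL → Poly
  | g :: gs, σ :: σs => add (mulShort σ.poly (normMS g)) (ineqPartL gs σs)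
  | _, _ => []

/-- The equality part `Σⱼ hⱼ · tⱼ` (both factors merge-sort normalised, shorter factor outside).
[cite: BlekhermanParriloThomas2012, Thm 3.127] -/
def eqPartL : List Poly → List Poly → Poly
  | h :: hs, t :: ts => add (mulShort (normMS h) (normMS t)) (eqPartL hs ts)
  | _, _ => []

/-- The equality part vanishes wherever the hypotheses `hⱼ = 0` hold.
[cite: BlekhermanParriloThomas2012, Thm 3.127] -/
theorem eval_eqPartL (x : ℕ → R) :
    ∀ (hs ts : List Poly), (∀ h ∈ hs, eval x h = 0) → eval x (eqPartL hs ts) = 0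
  | h :: hs, t :: ts, hh => by
      rw [eqPartL, eval_add, eval_mulShort, eval_normMS, eval_normMS, hh h List.mem_cons_self,
        zero_mul, zero_add]
      exact eval_eqPartL x hs ts fun h' hh' => hh h' (List.mem_cons_of_mem _ hh')
  | [], _, _ => by simp [eqPartL]
  | _ :: _, [], _ => by simp [eqPartL]

/-- **Row-range-split residual** `p − (Σ_t P_t + Σᵢ gᵢσᵢ + Σⱼ hⱼtⱼ)`: the free block enters
through its shipped parts `P_t` (certified separately by `GramL.ChunkEqs`). [cite: BlekhermanParriloThomas2012, Thm 3.127] -/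
def residualL (p : Poly) (gs hs : List Poly) (parts : List Poly) (ineq : List GramL)
    (eqMult : List Poly) : Poly :=
  add (normMS p) (neg (add (sumPolys parts) (add (ineqPartL gs ineq) (eqPartL hs eqMult))))

/-- **Unsplit list residual** `p − (σ₀ + Σᵢ gᵢσᵢ + Σⱼ hⱼtⱼ)` with the free block computed in
place (one `decide` per identity; the list-carrier twin of `residualGR`). [cite: BlekhermanParriloThomas2012, Thm 3.127] -/
def residualL1 (p : Poly) (gs hs : List Poly) (free : GramL) (ineq : List GramL)
    (eqMult : List Poly) : Poly :=
  add (normMS p) (neg (add free.poly (add (ineqPartL gs ineq) (eqPartL hs eqMult))))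

end CharZero

section Ordered

variable {R : Type*} [Field R] [LinearOrder R] [IsStrictOrderedRing R]

/-- The list inequality part is nonnegative wherever the hypotheses hold, from `QuadNonneg` of
each multiplier block. [cite: BlekhermanParriloThomas2012, Thm 3.127] -/
theorem eval_ineqPartL_nonneg (x : ℕ → R) :
    ∀ (gs : List Poly) (σs : List GramL), (∀ g ∈ gs, 0 ≤ eval x g) →
      (∀ σ ∈ σs, σ.toGramSOS.QuadNonneg R) → 0 ≤ eval x (ineqPartL gs σs)
  | g :: gs, σ :: σs, hg, hσ => by
      rw [ineqPartL, eval_add, eval_mulShort, eval_normMS]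
      exact add_nonneg
        (mul_nonneg (σ.eval_poly_nonneg_of_quadNonneg (hσ σ List.mem_cons_self) x)
          (hg g List.mem_cons_self))
        (eval_ineqPartL_nonneg x gs σs (fun g' hg' => hg g' (List.mem_cons_of_mem _ hg'))
          (fun σ' hσ' => hσ σ' (List.mem_cons_of_mem _ hσ')))
  | [], _, _, _ => by simp [ineqPartL]
  | _ :: _, [], _, _ => by simp [ineqPartL]

/-- **Soundness, ROW-RANGE-SPLIT form.** From: the free block's `Q` has `s` rows (`hQ`, a
`decide`), the ranges `ns` tile all rows (`hcov`, a `decide`), the shipped parts are the range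
polynomials (`hparts`, one `decide +kernel` per range, in any number of files), `QuadNonneg` of
the free block and of every multiplier block (any PSD lane), and the zero test of the small
residual `residualL` (one `decide +kernel`) — conclude `p(x) ≥ 0` wherever the hypotheses hold.
[cite: BlekhermanParriloThomas2012, Thm 3.127] -/
theorem nonneg_of_chunksL {p : Poly} {gs hs : List Poly} {free : GramL} {ineq : List GramL}
    {eqMult parts : List Poly} {ns : List ℕ} (hQ : free.Q.length = free.s) (hcov : free.s ≤ ns.sum)
    (hparts : free.ChunkEqs 0 ns parts) (hf : free.toGramSOS.QuadNonneg R)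
    (hσ : ∀ σ ∈ ineq, σ.toGramSOS.QuadNonneg R)
    (hz : isZero (residualL p gs hs parts ineq eqMult) = true)
    (x : ℕ → R) (hg : ∀ g ∈ gs, 0 ≤ eval x g) (hh : ∀ h ∈ hs, eval x h = 0) : 0 ≤ eval x p := by
  have h0 := eval_eq_zero_of_isZero x hz
  rw [residualL, eval_add, eval_normMS, eval_neg, eval_add, eval_add, eval_sumPolys,
    GramL.ChunkEqs.sum_eq_poly free x hQ hcov hparts] at h0
  have h1 := free.eval_poly_nonneg_of_quadNonneg hf x
  have h2 := eval_ineqPartL_nonneg x gs ineq hg hσ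
  have h3 := eval_eqPartL x hs eqMult hh
  linarith

/-- **Soundness, unsplit list form** (one `decide +kernel` for the residual `residualL1`).
[cite: BlekhermanParriloThomas2012, Thm 3.127] -/
theorem nonneg_of_quadL {p : Poly} {gs hs : List Poly} {free : GramL} {ineq : List GramL}
    {eqMult : List Poly} (hf : free.toGramSOS.QuadNonneg R)
    (hσ : ∀ σ ∈ ineq, σ.toGramSOS.QuadNonneg R)
    (hz : isZero (residualL1 p gs hs free ineq eqMult) = true)
    (x : ℕ → R) (hg : ∀ g ∈ gs, 0 ≤ eval x g) (hh : ∀ h ∈ hs, eval x h = 0) : 0 ≤ eval x p := by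
  have h0 := eval_eq_zero_of_isZero x hz
  rw [residualL1, eval_add, eval_normMS, eval_neg, eval_add, eval_add] at h0
  have h1 := free.eval_poly_nonneg_of_quadNonneg hf x
  have h2 := eval_ineqPartL_nonneg x gs ineq hg hσ
  have h3 := eval_eqPartL x hs eqMult hh
  linarith

end Ordered

end Poly

/-! ### Tests / usage templates (kernel-checked) -/

section TestsL

open Poly

/-- Test (unsplit list form, ℚ lane through the view): for `t ≥ 0`, `t³ − t² + t ≥ 0` with the
Gram multiplier `(1 t) Q (1 t)ᵀ`, `Q = [[1, -1/2], [-1/2, 1]]`, on `g = t` and a rounded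
sub-certificate (`d`, `B` by rows) — the `GramSOSRows.lean` example on list carriers. -/
example (t : ℝ) (ht : 0 ≤ t) : t ^ 2 ≤ t ^ 3 + t := by
  let σ : GramL := ⟨[([] : List ℕ), ([1] : List ℕ)], [[1, -1 / 2], [-1 / 2, 1]], [1, 7 / 10],
    [[1, -1 / 2], [0, 1]]⟩
  have hσ : σ.toGramSOS.QuadNonneg ℝ := σ.toGramSOS.quadNonneg_of_valid (by decide +kernel)
  have h := nonneg_of_quadL
    (p := [(([1] : List ℕ), (1 : ℚ)), (([2] : List ℕ), (-1 : ℚ)), (([3] : List ℕ), (1 : ℚ))])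
    (gs := [X 0]) (hs := []) (free := ⟨[], [], [], []⟩) (ineq := [σ]) (eqMult := [])
    (GramL.quadNonneg_of_nil _ rfl) (by simpa using hσ) (by decide +kernel) (vars [t])
    (by simpa using ht) (by simp)
  simp only [eval_cons, eval_nil, Monomial.eval_eq, Monomial.evalFrom_cons, Monomial.evalFrom_nil,
    vars_cons_zero] at h
  push_cast at h
  linarith

/-- Test (ROW-RANGE-SPLIT form with the INTEGER PSD lane): `2a² − 2ab + 2b² ≥ 0`, free block
`Q = [[2, -1], [-1, 2]]` in the basis `(a, b)`; the two rows are shipped as the parts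
`P₀ = 2a² − ab` and `P₁ = −ab + 2b²` (each equality its own `decide`), the PSD fact comes from
the integer certificate of `A = 4 • Q` (`d = (2, 1)`, `B = [[2, -1], [0, 2]]`) with the scaling
tested by `scaleOK`. -/
example (a b : ℝ) : 0 ≤ 2 * a ^ 2 - 2 * a * b + 2 * b ^ 2 := by
  let σ : GramL := ⟨[([1] : List ℕ), ([0, 1] : List ℕ)], [[2, -1], [-1, 2]], [], []⟩
  have hq : σ.toGramSOS.QuadNonneg ℝ :=
    σ.quadNonneg_of_gramCertZ (Arows := [[8, -4], [-4, 8]]) (d := ![2, 1]) (B := !![2, -1; 0, 2])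
      (c := 4) (by decide +kernel) (by norm_num) (by decide +kernel)
  have hparts : σ.ChunkEqs 0 [1, 1]
      [[(([2] : List ℕ), (2 : ℚ)), (([1, 1] : List ℕ), (-1 : ℚ))],
        [(([1, 1] : List ℕ), (-1 : ℚ)), (([0, 2] : List ℕ), (2 : ℚ))]] :=
    ⟨by decide +kernel, by decide +kernel, trivial⟩
  have h := nonneg_of_chunksL (gs := []) (hs := []) (ineq := []) (eqMult := [])
    (p := [(([0, 2] : List ℕ), (2 : ℚ)), (([1, 1] : List ℕ), (-2 : ℚ)), (([2] : List ℕ), (2 : ℚ))])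
    (by decide) (by decide) hparts hq (by simp) (by decide +kernel) (vars [a, b]) (by simp) (by simp)
  simp only [eval_cons, eval_nil, Monomial.eval_eq, Monomial.evalFrom_cons, Monomial.evalFrom_nil,
    vars_cons_zero, vars_cons_succ] at h
  push_cast at h
  linarith

end TestsL

/-! ### Appendix (2026-08-27): positional shape guard for emitters -/

namespace Poly

/-- **Shape guard for the positional multiplier lists.** `ineqPartL gs σs` and `eqPartL hs ts` pair
hypotheses with multipliers BY POSITION and stop at the shorter list: a surplus multiplier (more
`σ` than `g`, more `t` than `h`) is silently DROPPED and a missing one counts as `0`. Both are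
sound (the soundness theorems quantify over `g ∈ gs`, `h ∈ hs` only), but an emitter that
mis-pairs would see it only as a failed residual test, never as an error (review note of the
soundness read, 2026-08-27). This decidable guard — lengths agree — is meant to be `decide`d next
to the residual so that such a bug is reported where it happens. [cite: BlekhermanParriloThomas2012, Thm 3.127] -/
def certShapeOK (gs : List Poly) (ineq : List GramL) (hs eqMult : List Poly) : Bool :=
  (gs.length == ineq.length) && (hs.length == eqMult.length)

/-- The guard unfolds to the two length equalities. [cite: BlekhermanParriloThomas2012, Thm 3.127] -/
theorem certShapeOK_iff (gs : List Poly) (ineq : List GramL) (hs eqMult : List Poly) :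
    certShapeOK gs ineq hs eqMult = true ↔ gs.length = ineq.length ∧ hs.length = eqMult.length := by
  simp [certShapeOK, Bool.and_eq_true]

end Poly

/-- Test (shape guard): two hypotheses, two multipliers; one equality, one multiplier. -/
example : Poly.certShapeOK [Poly.X 0, Poly.X 1] [⟨[], [], [], []⟩, ⟨[], [], [], []⟩] [Poly.X 2] [Poly.C 1] = true := by
  decide

/-! ### Appendix B (2026-08-27): K-SUM2 — a SECOND SUMMATION LEVEL (slices of every summand and
of the target), so that no declaration ever merges all parts or the whole target

Booked by gridfusion-lead (2026-08-27T03:40:40Z, lever «K-SUM2») on a dense identity whose free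
block has 396 rows and whose target has ≈ 31.8 k terms: with the row-range split alone, the LAST
step — `residualL`, merging ≈ 130 shipped parts into the target — is one non-splittable `decide`
estimated at 300–900 s. Here the producer ships a ROW-MAJOR MATRIX of polynomials instead: row
`t` = ONE SUMMAND of the identity (a row-range part of the free block, or a shipped multiplier
product `σᵢ.poly · gᵢ`, or a shipped equality product `hⱼ · tⱼ`), column `v` = that summand's
`v`-th SLICE (any split of its term list; slicing every summand by the same monomial-key ranges
is what makes each column identity hold exactly), and the target as its slices
`pS = [p₀, …, p_{V−1}]`, read back as `pS.flatten`. Kernel facts, each ONE `decide +kernel` in a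
file of its own: LEVEL 1 = the unchanged `GramL.ChunkEqs` on the row-flattened parts
(`Pm.map List.flatten`) plus `Poly.MultEqs` / `Poly.EqMultEqs` for the shipped products;
LEVEL 2 = one `Poly.SliceEqs` conjunct per column, `p_v ≡ Σ_rows row[v]` (cost ∝ the terms IN
THAT SLICE only); and the shape test `Poly.rowsFit` (every row has ≤ `V` cells). Soundness
**`Poly.nonneg_of_slicesL`**: `eval` is additive over `++` (`Poly.eval_append`), hence
`eval pS.flatten = Σ_v eval p_v = Σ_v Σ_rows eval row[v] = Σ_rows Σ_v eval row[v]
= Σ_rows eval row.flatten`, and the rows are the certified summands — NO hypothesis on how the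
producer sliced is needed (the slicing only decides whether the column tests come out `true`).
Same conclusion shape as `nonneg_of_chunksL` / `nonneg_of_quadGR`.
[cite: BlekhermanParriloThomas2012, Thm 3.127] -/

namespace Poly

section SlicesEval

variable {R : Type*} [Field R] [CharZero R]

omit [CharZero R] in
/-- `eval` of a flattened list of term lists is the sum of the `eval`s — additivity of evaluation
over `++`, the form in which the summands of the certificate identity (3.30) are re-assembled from
their shipped slices. [cite: BlekhermanParriloThomas2012, Thm 3.127] -/
theorem eval_flatten (x : ℕ → R) : ∀ Ps : List Poly, eval x Ps.flatten = (Ps.map (eval x)).sum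
  | [] => by simp
  | P :: Ps => by
      rw [List.flatten_cons, eval_append, eval_flatten x Ps, List.map_cons, List.sum_cons]

/-- Column `v` of a row-major matrix of polynomial slices; a missing cell reads as `[]` (value 0).
[folklore] -/
def col (Rm : List (List Poly)) (v : ℕ) : List Poly := Rm.map fun row => row.getD v []

/-- Shape test: every row of the slice matrix has at most `V` cells (so that columns `0 … V−1`
see every cell). One `decide`. [folklore] -/
def rowsFit (Rm : List (List Poly)) (V : ℕ) : Bool := Rm.all fun row => decide (row.length ≤ V)

/-- **Slice equalities** (LEVEL 2 of K-SUM2): from column `v` on, the target slices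
`p_v, p_{v+1}, …` are, column by column, the sums of the rows' cells —
`isZero (normMS p_v − sumPolys (col Rm v)) = true`, each conjunct ONE `decide +kernel`
(typically in its own file), assembled by `⟨h₀, h₁, …, trivial⟩`.
[cite: BlekhermanParriloThomas2012, Thm 3.127] -/
def SliceEqs (Rm : List (List Poly)) : ℕ → List Poly → Prop
  | v, pv :: pS => isZero (add (normMS pv) (neg (sumPolys (col Rm v)))) = true ∧ SliceEqs Rm (v + 1) pS
  | _, [] => True

/-- **Multiplier-product equalities**: `Ms = [M₀, M₁, …]` are the shipped products
`σᵢ.poly · gᵢ` of `ineqPartL gs σs`, BY POSITION with the same stop-at-the-shorter-list rule as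
`ineqPartL` (a surplus or missing `M` is `False`); each conjunct ONE `decide +kernel`.
[cite: BlekhermanParriloThomas2012, Thm 3.127] -/
def MultEqs : List Poly → List GramL → List Poly → Prop
  | g :: gs, σ :: σs, M :: Ms =>
      isZero (add (normMS M) (neg (mulShort σ.poly (normMS g)))) = true ∧ MultEqs gs σs Ms
  | _ :: _, _ :: _, [] => False
  | _, _, [] => True
  | _, _, _ :: _ => False

/-- **Equality-product equalities**: `Es = [E₀, E₁, …]` are the shipped products `hⱼ · tⱼ` of
`eqPartL hs ts`, by position (same stopping rule as `eqPartL`); each conjunct ONE `decide +kernel`.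
[cite: BlekhermanParriloThomas2012, Thm 3.127] -/
def EqMultEqs : List Poly → List Poly → List Poly → Prop
  | h :: hs, t :: ts, E :: Es =>
      isZero (add (normMS E) (neg (mulShort (normMS h) (normMS t)))) = true ∧ EqMultEqs hs ts Es
  | _ :: _, _ :: _, [] => False
  | _, _, [] => True
  | _, _, _ :: _ => False

/-- The shipped multiplier products evaluate like `ineqPartL`.
[cite: BlekhermanParriloThomas2012, Thm 3.127] -/
theorem MultEqs.sum_eq (x : ℕ → R) : ∀ (gs : List Poly) (σs : List GramL) (Ms : List Poly),
    MultEqs gs σs Ms → (Ms.map (eval x)).sum = eval x (ineqPartL gs σs)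
  | g :: gs, σ :: σs, M :: Ms, h => by
      simp only [MultEqs] at h
      have e := eval_eq_zero_of_isZero x h.1
      rw [eval_add, eval_normMS, eval_neg] at e
      rw [List.map_cons, List.sum_cons, ineqPartL, eval_add, MultEqs.sum_eq x gs σs Ms h.2]
      linear_combination e
  | _ :: _, _ :: _, [], h => by simp [MultEqs] at h
  | [], _, [], _ => by simp [ineqPartL]
  | _ :: _, [], [], _ => by simp [ineqPartL]
  | [], _, _ :: _, h => by simp [MultEqs] at h
  | _ :: _, [], _ :: _, h => by simp [MultEqs] at h

/-- The shipped equality products evaluate like `eqPartL`.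
[cite: BlekhermanParriloThomas2012, Thm 3.127] -/
theorem EqMultEqs.sum_eq (x : ℕ → R) : ∀ (hs ts Es : List Poly),
    EqMultEqs hs ts Es → (Es.map (eval x)).sum = eval x (eqPartL hs ts)
  | h₀ :: hs, t :: ts, E :: Es, h => by
      simp only [EqMultEqs] at h
      have e := eval_eq_zero_of_isZero x h.1
      rw [eval_add, eval_normMS, eval_neg] at e
      rw [List.map_cons, List.sum_cons, eqPartL, eval_add, EqMultEqs.sum_eq x hs ts Es h.2]
      linear_combination e
  | _ :: _, _ :: _, [], h => by simp [EqMultEqs] at h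
  | [], _, [], _ => by simp [eqPartL]
  | _ :: _, [], [], _ => by simp [eqPartL]
  | [], _, _ :: _, h => by simp [EqMultEqs] at h
  | _ :: _, [], _ :: _, h => by simp [EqMultEqs] at h

/-- The target slices sum, column by column, to the column sums of the matrix.
[cite: BlekhermanParriloThomas2012, Thm 3.127] -/
theorem SliceEqs.sum_eq (Rm : List (List Poly)) (x : ℕ → R) : ∀ (v : ℕ) (pS : List Poly),
    SliceEqs Rm v pS →
      (pS.map (eval x)).sum = ∑ k ∈ Finset.range pS.length, ((col Rm (v + k)).map (eval x)).sum
  | v, [], _ => by simp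
  | v, pv :: pS, h => by
      simp only [SliceEqs] at h
      have e := eval_eq_zero_of_isZero x h.1
      rw [eval_add, eval_normMS, eval_neg, eval_sumPolys] at e
      rw [List.map_cons, List.sum_cons, List.length_cons, Finset.sum_range_succ',
        SliceEqs.sum_eq Rm x (v + 1) pS h.2, Nat.add_zero]
      have hc : ∑ k ∈ Finset.range pS.length, ((col Rm (v + 1 + k)).map (eval x)).sum
          = ∑ k ∈ Finset.range pS.length, ((col Rm (v + (k + 1))).map (eval x)).sum :=
        Finset.sum_congr rfl fun k _ => by rw [Nat.add_right_comm, Nat.add_assoc]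
      rw [hc]
      linear_combination e

omit [CharZero R] in
/-- Column sums re-associated as row sums (finite double sum swap on ragged rows; missing cells
are `0`). [folklore] -/
private theorem sum_cols_eq_sum_rows (x : ℕ → R) (V : ℕ) : ∀ Rm : List (List Poly),
    ∑ k ∈ Finset.range V, ((col Rm k).map (eval x)).sum
      = (Rm.map fun row => ∑ k ∈ Finset.range V, eval x (row.getD k [])).sum
  | [] => by simp [col]
  | row :: Rm => by
      have ih := sum_cols_eq_sum_rows x V Rm
      simp only [col, List.map_cons, List.sum_cons, List.map_map] at ih ⊢
      rw [Finset.sum_add_distrib, ih]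

omit [CharZero R] in
/-- A row with at most `V` cells: the sum of its first `V` cells (missing ones `0`) is the value
of its flattening. [folklore] -/
private theorem sum_getD_eq_eval_flatten (x : ℕ → R) : ∀ (V : ℕ) (row : List Poly), row.length ≤ V →
    ∑ k ∈ Finset.range V, eval x (row.getD k []) = eval x row.flatten
  | 0, [], _ => by simp
  | 0, _ :: _, h => by simp at h
  | V + 1, [], _ => by simp
  | V + 1, c :: cs, h => by
      have h' : cs.length ≤ V := by simp only [List.length_cons] at h; omega
      rw [Finset.sum_range_succ', List.flatten_cons, eval_append,
        ← sum_getD_eq_eval_flatten x V cs h']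
      simp only [List.getD_cons_succ, List.getD_cons_zero]
      rw [add_comm]

/-- **LEVEL-2 soundness**: if every row fits in `V = |pS|` cells and the slice equalities hold,
the flattened target evaluates to the sum of the flattened rows.
[cite: BlekhermanParriloThomas2012, Thm 3.127] -/
theorem SliceEqs.eval_flatten_eq (Rm : List (List Poly)) (x : ℕ → R) {pS : List Poly}
    (hfit : rowsFit Rm pS.length = true) (h : SliceEqs Rm 0 pS) :
    eval x pS.flatten = (Rm.map fun row => eval x row.flatten).sum := by
  rw [eval_flatten, SliceEqs.sum_eq Rm x 0 pS h]
  simp only [Nat.zero_add]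
  rw [sum_cols_eq_sum_rows x pS.length Rm]
  have hrows : ∀ row ∈ Rm, row.length ≤ pS.length := by
    simpa [rowsFit, List.all_eq_true] using hfit
  congr 1
  exact List.map_congr_left fun row hrow => sum_getD_eq_eval_flatten x _ row (hrows row hrow)

end SlicesEval

section SlicesOrdered

variable {R : Type*} [Field R] [LinearOrder R] [IsStrictOrderedRing R]

/-- **Soundness of K-SUM2 (row ranges × slices).** Data: `Pm`, `Mm`, `Em` = row-major slice
matrices of the free block's row-range parts, of the multiplier products and of the equality
products; `pS` = the target's slices (target = `pS.flatten`). Kernel facts: `hQ`, `hcov`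
(`decide`), LEVEL 1 `hparts` (`ChunkEqs` on `Pm.map List.flatten`), `hmult`, `heqm` (one `decide`
per shipped product), `hfit` (`decide`), LEVEL 2 `hslices` (one `decide` per slice); PSD facts
`hf`, `hσ` from any lane. Conclusion: `0 ≤ (pS.flatten).eval x` wherever `g ≥ 0` for `g ∈ gs`
and `h = 0` for `h ∈ hs`. [cite: BlekhermanParriloThomas2012, Thm 3.127] -/
theorem nonneg_of_slicesL {pS gs hs eqMult : List Poly} {free : GramL} {ineq : List GramL}
    {Pm Mm Em : List (List Poly)} {ns : List ℕ}
    (hQ : free.Q.length = free.s) (hcov : free.s ≤ ns.sum)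
    (hparts : free.ChunkEqs 0 ns (Pm.map List.flatten))
    (hmult : MultEqs gs ineq (Mm.map List.flatten))
    (heqm : EqMultEqs hs eqMult (Em.map List.flatten))
    (hfit : rowsFit (Pm ++ Mm ++ Em) pS.length = true)
    (hslices : SliceEqs (Pm ++ Mm ++ Em) 0 pS)
    (hf : free.toGramSOS.QuadNonneg R) (hσ : ∀ σ ∈ ineq, σ.toGramSOS.QuadNonneg R)
    (x : ℕ → R) (hg : ∀ g ∈ gs, 0 ≤ eval x g) (hh : ∀ h ∈ hs, eval x h = 0) :
    0 ≤ eval x pS.flatten := by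
  rw [SliceEqs.eval_flatten_eq _ x hfit hslices, List.map_append, List.map_append,
    List.sum_append, List.sum_append]
  have e1 : (Pm.map fun row => eval x row.flatten).sum = free.poly.eval x := by
    rw [← GramL.ChunkEqs.sum_eq_poly free x hQ hcov hparts, List.map_map]; rfl
  have e2 : (Mm.map fun row => eval x row.flatten).sum = eval x (ineqPartL gs ineq) := by
    rw [← MultEqs.sum_eq x gs ineq _ hmult, List.map_map]; rfl
  have e3 : (Em.map fun row => eval x row.flatten).sum = 0 := by
    rw [← eval_eqPartL x hs eqMult hh, ← EqMultEqs.sum_eq x hs eqMult _ heqm, List.map_map]; rfl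
  rw [e1, e2, e3, add_zero]
  exact add_nonneg (free.eval_poly_nonneg_of_quadNonneg hf x) (eval_ineqPartL_nonneg x gs ineq hg hσ)

end SlicesOrdered

end Poly

/-- Test (K-SUM2, rows × slices): `2a² − 2ab + 2b² ≥ 0` — free block `Q = [[2, -1], [-1, 2]]` in
the basis `(a, b)` (integer PSD lane as above); LEVEL 1: the two rows as parts `P₀ = 2a² − ab`,
`P₁ = −ab + 2b²`, each SHIPPED IN TWO SLICES (column 0 = the `a²`, `ab` terms, column 1 = the
`b²` terms); LEVEL 2: the target slices `p₀ = 2a² − 2ab`, `p₁ = 2b²` are the column sums; the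
target is `[p₀, p₁].flatten`. Every equality is its own `decide +kernel`. -/
example (a b : ℝ) : 0 ≤ 2 * a ^ 2 - 2 * a * b + 2 * b ^ 2 := by
  let σ : GramL := ⟨[([1] : List ℕ), ([0, 1] : List ℕ)], [[2, -1], [-1, 2]], [], []⟩
  have hq : σ.toGramSOS.QuadNonneg ℝ :=
    σ.quadNonneg_of_gramCertZ (Arows := [[8, -4], [-4, 8]]) (d := ![2, 1]) (B := !![2, -1; 0, 2])
      (c := 4) (by decide +kernel) (by norm_num) (by decide +kernel)
  let Pm : List (List Poly) :=
    [[[(([2] : List ℕ), (2 : ℚ)), (([1, 1] : List ℕ), (-1 : ℚ))], []],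
     [[(([1, 1] : List ℕ), (-1 : ℚ))], [(([0, 2] : List ℕ), (2 : ℚ))]]]
  let pS : List Poly :=
    [[(([2] : List ℕ), (2 : ℚ)), (([1, 1] : List ℕ), (-2 : ℚ))], [(([0, 2] : List ℕ), (2 : ℚ))]]
  have hparts : σ.ChunkEqs 0 [1, 1] (Pm.map List.flatten) :=
    ⟨by decide +kernel, by decide +kernel, trivial⟩
  have hsl : Poly.SliceEqs (Pm ++ [] ++ []) 0 pS := ⟨by decide +kernel, by decide +kernel, trivial⟩
  have h := Poly.nonneg_of_slicesL (gs := []) (hs := []) (ineq := []) (eqMult := []) (Mm := [])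
    (Em := []) (by decide) (by decide) hparts (by simp [Poly.MultEqs]) (by simp [Poly.EqMultEqs])
    (by decide) hsl hq (by simp) (vars [a, b]) (by simp) (by simp)
  simp only [pS, List.flatten_cons, List.flatten_nil, List.cons_append, List.nil_append,
    Poly.eval_cons, Poly.eval_nil, Monomial.eval_eq, Monomial.evalFrom_cons, Monomial.evalFrom_nil,
    vars_cons_zero, vars_cons_succ] at h
  push_cast at h
  linarith

end SOS

end Literature.Computation.Certificates
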